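import Literature.AlgebraicGeometry.ModuliOfAbelianVarieties.SiegelAdmissiblePackageAlongPullbacks      -- ★ RD-T3 `SiegelAdelicMarking.exists_admPackage_along_isBaseChangeVia₂`
import Literature.AlgebraicGeometry.ModuliOfAbelianVarieties.SiegelAdmissibleClassifiedAtAnyRep         -- ★ p850754∕p850771∕p850827 (LA4-p02): `pts_comp_classifyingMap_eq_mk_of_mover`
import Literature.AlgebraicGeometry.AbelianSchemes.PolarizedAbelianSchemeWithLevelBaseChange             -- ★ `PolarizedAbelianSchemeWithLevel.baseChange`, `baseChange_isBaseChangeVia`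
import HarnessLib

/-!
# Admissibility of the base change `T|ₓ` of a family from an (ADM)-package in FIBRE currency at `x`; the sheet line՚s `ε₂` point reading in one call
# ([MFK94] Ch. 7 §2 Def. 7.2–7.3; [Milne 2005] Thm. 6.11)

Topic `AlgebraicGeometry/ModuliOfAbelianVarieties`, namespace `Literature.AlgebraicGeometry.ModuliOfAbelianVarieties` (+ `SiegelFineModuliScheme`).
THEOREMS ONLY (no definition, no instance, no notation, no named fact, no `sorry`).  Cell `hodgecm-mathlib` (D-0151), P6 «MOD programme», crux hLiu418
(stmt-HodgeConjecture-24832, `--supports`, count-neutral), line «L4», (S8) closer `Lines/F0_P6a_StubESHEET.lean`, road (γ′), DEAL #38 «`hε₂`» (LA4-p02 (g2)) — the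
BRIDGE between the currency in which the marked Serre-tensor fibre is produced (DEAL #42, LA4-p03 (g3): a marking of `(T.A.fibre x).toAbelianVariety`, an ample `Θ` with
`T.A.IsLambdaOfAt x …`, a symplectic lift `Λ : T.level.SymplecticLift x Θ δ` with its tower — DEAL #41, LA5-p02 (g4)) and the currency of ★ (U)՚s `IsAdmissibleAt`
(a package of the triple `T.baseChange x` over `Spec ℂ` at the identity point).

* §1 **`isAdmissibleAt_baseChange_of_admPackage`** — fibre-currency package at `x` ⇒ `IsAdmissibleAt hδ r Z hZ (T.baseChange x)` (one call of ★ RD-T3 with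
  `P₁ := T` along `𝟙`, `P₂ := T.baseChange x` along `x`, points `x` and `𝟙`).
* §2 **`pts_comp_classifyingMap_eq_mk_of_admPackage_of_mover`** — §1 fed to ★ `pts_comp_classifyingMap_eq_mk_of_mover`: the complex point `x ≫ φ`, `φ` the classifying
  map of `T`, has Shimura-set shadow `[J, s·K_δ(N)]` for any moved representative `(J, s)` of `[J(Z), r]` — the sheet line՚s `hε₂` from DEAL #42՚s eight names directly.

## References
* [MumfordFogartyKirwan1994] D. Mumford, J. Fogarty, F. Kirwan, *Geometric Invariant Theory* (3rd ed. 1994), Ch. 7 §2 Def. 7.2 (p. 129), Def. 7.3 (p. 130).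
* [Milne2005ShimuraVarieties] J. S. Milne, *Introduction to Shimura varieties* (2005; rev. 2017), §5 Lemma 5.13 p. 57; §6 Thm. 6.11 pp. 74–75.
* [Lan2013PELCompactifications] K.-W. Lan, *Arithmetic compactifications of PEL-type Shimura varieties* (2013), §1.3.6 Lemma 1.3.6.5 (p. 81).
-/

set_option autoImplicit false

noncomputable section

open CategoryTheory CategoryTheory.Limits AlgebraicGeometry Matrix
open Literature.AlgebraicGeometry.Motives (SchemeOver ComplexPoints AlgPoints specOver CartierDivisor)
open Literature.AlgebraicGeometry.AbelianSchemes (PolarizedAbelianSchemeWithLevel)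
open Literature.NumberTheory.Automorphic (siegelUpperHalfSpace)

namespace Literature.AlgebraicGeometry.ModuliOfAbelianVarieties

open SiegelModuli (jOfSiegel)

variable {g N : ℕ} {δ : Fin g → ℕ}

/-! ### §1 Fibre-currency package at `x` ⇒ admissibility of `T.baseChange x` -/

/-- **ADMISSIBILITY OF `T|ₓ` FROM AN (ADM)-PACKAGE IN FIBRE CURRENCY.**  For a polarised abelian scheme with level-`N` structure `T` over a scheme `S`, a complex
point `x : Spec ℂ → S`, and at `x`: a marking `m` of the fibre `(T.A.fibre x)` by `[J(Z), r]`, an ample `Θ` with `λ̄ = Λ(𝒪(Θ))` there, and a symplectic lift `Λ` of the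
level structure at `x` whose tower read through `r` is `m.r` — the base change `T.baseChange x` (a triple over `Spec ℂ`) is admissible at `(Z, r)` in the sense of
★ (U).  One call of ★ RD-T3 `exists_admPackage_along_isBaseChangeVia₂` (`P₁ := T` along `𝟙 S` at `x`, `P₂ := T.baseChange x` along `x` at `𝟙`).
[cite: MumfordFogartyKirwan1994, Ch. 7 §2 Definition 7.2 (p. 129) and Definition 7.3 (p. 130)] [cite: Milne2005ShimuraVarieties, §6 Thm. 6.11 pp. 74–75]
[cite: Lan2013PELCompactifications, §1.3.6 Lemma 1.3.6.5 (p. 81)] -/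
theorem isAdmissibleAt_baseChange_of_admPackage (hδ : IsPolarizationType δ) {S : Scheme.{0}} (T : PolarizedAbelianSchemeWithLevel g N δ S)
    (x : Spec (.of ℂ) ⟶ S) {r : gspFinAdelic δ} {Z : Matrix (Fin g) (Fin g) ℂ} {hZ : Z ∈ siegelUpperHalfSpace g}
    (m : SiegelAdelicMarking ⟨jOfSiegel δ Z, SiegelComplexRecordSystem.jOfSiegel_mem_C0pm hδ.1 hZ⟩ r (T.A.fibre x).toAbelianVariety)
    (Θ : CartierDivisor (T.A.fibre x).toAbelianVariety.X.left) (Λ : T.level.SymplecticLift x Θ δ)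
    (hample : Θ.IsAmple) (hlam : T.A.IsLambdaOfAt x T.D T.pol.lam Θ)
    (htower : ∀ ⦃K : ℕ⦄, N ∣ K → K ≠ 0 → ∀ (y : Fin g ⊕ Fin g → ZMod K) (v : Fin g ⊕ Fin g → ℚ),
      AdelicCongr ((r⁻¹ : gspFinAdelic δ) : GL (Fin g ⊕ Fin g) finAdeleQ) 1 v (fun i => ((y i).val : ℚ) / K) →
        ((Λ.lift K (Multiplicative.ofAdd y)) : (T.A.fibre x).toAbelianVariety.Points ℂ) = m.r v) :
    IsAdmissibleAt hδ r Z hZ (T.baseChange x) := by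
  have hp : 𝟙 (Spec (.of ℂ)) ≫ x = x ≫ 𝟙 S := by rw [Category.id_comp, Category.comp_id]
  obtain ⟨-, -, -, -, m₂, Θ₂, Λ₂, hample₂, hlam₂, htower₂, -⟩ :=
    SiegelAdelicMarking.exists_admPackage_along_isBaseChangeVia₂ (PolarizedAbelianSchemeWithLevel.IsBaseChangeVia.refl T)
      (T.baseChange_isBaseChangeVia x) hp hδ (hZ := hZ) m Θ Λ hample hlam htower
  exact ⟨m₂, Θ₂, Λ₂, hample₂, hlam₂, htower₂⟩

/-! ### §2 The `ε₂` point reading in one call from fibre-currency data -/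

namespace SiegelFineModuliScheme

variable (hδ : IsPolarizationType δ) (𝓜 : SiegelFineModuliScheme g N δ)
  (Sc : (ZMod N)ˣ → SchemeOver ℂ) (ιc : ∀ c, Sc c ⟶ (Literature.AlgebraicGeometry.Motives.baseChange ℚ ℂ).obj 𝓜.M)
  (unif : ∀ c : (ZMod N)ˣ, Matrix (Fin g) (Fin g) ℂ → ComplexPoints (Sc c))
  (u : (ZMod N)ˣ → finAdeleQˣ) (rep : (ZMod N)ˣ → ↥(gspFinAdelic δ))
  (pts : ComplexPoints ((Literature.AlgebraicGeometry.Motives.baseChange ℚ ℂ).obj 𝓜.M) ≃ SiegelShimuraSet δ (principalLevelSubgroup δ N))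
  (rep_spec : ∀ c, (∀ w, Valued.v ((u c : finAdeleQ) w) = 1) ∧ (u c : finAdeleQ) - ((c : ZMod N).val : ℕ) ∈ levelIdeal N ∧
    rep c ∈ principalLevelSubgroup δ 1 ∧
      IsMultiplier (typeFormOver δ finAdeleQ) (rep c : GL (Fin g ⊕ Fin g) finAdeleQ) (u c) ∧
        ((rep c : GL (Fin g ⊕ Fin g) finAdeleQ) : Matrix (Fin g ⊕ Fin g) (Fin g ⊕ Fin g) finAdeleQ) =
          Matrix.fromBlocks 1 0 0 ((u c : finAdeleQ) • (1 : Matrix (Fin g) (Fin g) finAdeleQ)))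
  (pts_unif : ∀ (c : (ZMod N)ˣ) (W : Matrix (Fin g) (Fin g) ℂ) (hW : W ∈ siegelUpperHalfSpace g),
    pts (AlgPoints.map (ιc c) (unif c W)) =
      SiegelShimuraSet.mk δ (principalLevelSubgroup δ N)
        ⟨SiegelModuli.jOfSiegel δ W, C0_subset_C0pm δ (SiegelModuli.jOfSiegel_mem_C0 hδ.1 hW)⟩ (rep c))
  (junction : ∀ (c : (ZMod N)ˣ) (u' : finAdeleQˣ) (r : ↥(gspFinAdelic δ)),
    (∀ w, Valued.v ((u' : finAdeleQ) w) = 1) →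
    (u' : finAdeleQ) - ((c : ZMod N).val : ℕ) ∈ levelIdeal N →
    r ∈ principalLevelSubgroup δ 1 →
    IsMultiplier (typeFormOver δ finAdeleQ) (r : GL (Fin g ⊕ Fin g) finAdeleQ) u' →
    ((r : GL (Fin g ⊕ Fin g) finAdeleQ) : Matrix (Fin g ⊕ Fin g) (Fin g ⊕ Fin g) finAdeleQ) =
      Matrix.fromBlocks 1 0 0 ((u' : finAdeleQ) • (1 : Matrix (Fin g) (Fin g) finAdeleQ)) →
    ∀ (W : Matrix (Fin g) (Fin g) ℂ) (hW : W ∈ siegelUpperHalfSpace g),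
      haveI : IsLocallyNoetherian (specOver ℚ ℂ).left := inferInstanceAs (IsLocallyNoetherian (Spec (CommRingCat.of ℂ)))
      (∃ (P' : PolarizedAbelianSchemeWithLevel g N δ (specOver ℚ ℂ).left)
          (G : P'.A.X.left ⟶ 𝓜.univ.A.X.left) (Ĝ : P'.D.hat.X.left ⟶ 𝓜.univ.D.hat.X.left),
          P'.IsBaseChangeVia 𝓜.univ ((AlgPoints.baseChangeEquiv (algebraMap ℚ ℂ) 𝓜.M).symm (AlgPoints.map (ιc c) (unif c W))).left G Ĝ ∧
          IsAdmissibleAt hδ r W hW P') ∧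
      (∀ (P' : PolarizedAbelianSchemeWithLevel g N δ (specOver ℚ ℂ).left), IsAdmissibleAt hδ r W hW P' →
          AlgPoints.map (ιc c) (unif c W) = AlgPoints.baseChangeEquiv (algebraMap ℚ ℂ) 𝓜.M (𝓜.classifyingMap (specOver ℚ ℂ) P')))

include rep_spec pts_unif junction in
/-- **THE `ε₂` POINT READING FROM FIBRE-CURRENCY DATA, IN ONE CALL** (DEAL #38 «`hε₂`»): for a family `T` over a locally Noetherian `ℚ`-scheme `S`, a complex point
`x : Spec ℂ → S` (the sheet point `ℓ_{τE} z₀` read over `ℚ`), an (ADM)-package of `T` at `x` for `(Z, r)` in FIBRE currency (`m`, `Θ`, `Λ` as in §1 — DEAL #42 ⊕ #41), and a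
rational mover `q` with `q_ℝ⁻¹ J q_ℝ = J(Z)` and `q_𝔸 • rK = sK` (DEAL #42՚s `hJ₂`, `hq′` with `J := C.J v`, `s := C.b a·ũ_V(1,z)`): the complex point `x ≫ φ` of `𝓜`,
`φ := classifyingMap_S T`, has Shimura-set shadow `[J, s·K_δ(N)]`. [cite: Milne2005ShimuraVarieties, §5 Lemma 5.13 p. 57, §6 Thm. 6.11 pp. 74–75]
[cite: MumfordFogartyKirwan1994, Ch. 7 §2 Definitions 7.2–7.3 (p. 129)] -/
theorem pts_comp_classifyingMap_eq_mk_of_admPackage_of_mover (hg : 0 < g) (hN : 3 ≤ N)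
    (hcol : IsColimit (Cofan.mk ((Literature.AlgebraicGeometry.Motives.baseChange ℚ ℂ).obj 𝓜.M) ιc))
    (unif_surj : ∀ c, Set.SurjOn (unif c) (siegelUpperHalfSpace g) Set.univ)
    {S : SchemeOver ℚ} [IsLocallyNoetherian S.left] (T : PolarizedAbelianSchemeWithLevel g N δ S.left) (x : specOver ℚ ℂ ⟶ S)
    {r : ↥(gspFinAdelic δ)} {Z : Matrix (Fin g) (Fin g) ℂ} {hZ : Z ∈ siegelUpperHalfSpace g}
    (m : SiegelAdelicMarking ⟨jOfSiegel δ Z, SiegelComplexRecordSystem.jOfSiegel_mem_C0pm hδ.1 hZ⟩ r (T.A.fibre x.left).toAbelianVariety)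
    (Θ : CartierDivisor (T.A.fibre x.left).toAbelianVariety.X.left) (Λ : T.level.SymplecticLift x.left Θ δ)
    (hample : Θ.IsAmple) (hlam : T.A.IsLambdaOfAt x.left T.D T.pol.lam Θ)
    (htower : ∀ ⦃K : ℕ⦄, N ∣ K → K ≠ 0 → ∀ (y : Fin g ⊕ Fin g → ZMod K) (v : Fin g ⊕ Fin g → ℚ),
      AdelicCongr ((r⁻¹ : gspFinAdelic δ) : GL (Fin g ⊕ Fin g) finAdeleQ) 1 v (fun i => ((y i).val : ℚ) / K) →
        ((Λ.lift K (Multiplicative.ofAdd y)) : (T.A.fibre x.left).toAbelianVariety.Points ℂ) = m.r v)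
    (q : ↥(gspRational δ)) (J : C0pm δ) (s : ↥(gspFinAdelic δ))
    (hJ : conjJ (((gspRationalToReal δ q)⁻¹ : ↥(gspReal δ)) : GL (Fin g ⊕ Fin g) ℝ) (J : Matrix (Fin g ⊕ Fin g) (Fin g ⊕ Fin g) ℝ) = jOfSiegel δ Z)
    (hq : gspRationalToFinAdelic δ q • ((r : ↥(gspFinAdelic δ)) : ↥(gspFinAdelic δ) ⧸ principalLevelSubgroup δ N) =
      ((s : ↥(gspFinAdelic δ)) : ↥(gspFinAdelic δ) ⧸ principalLevelSubgroup δ N)) :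
    pts (AlgPoints.baseChangeEquiv (algebraMap ℚ ℂ) 𝓜.M (x ≫ 𝓜.classifyingMap S T)) = SiegelShimuraSet.mk δ (principalLevelSubgroup δ N) J s :=
  pts_comp_classifyingMap_eq_mk_of_mover hδ 𝓜 Sc ιc unif u rep pts rep_spec pts_unif junction hg hN hcol unif_surj T x (T.baseChange x.left)
    (T.baseChange_isBaseChangeVia x.left) (isAdmissibleAt_baseChange_of_admPackage hδ T x.left (hZ := hZ) m Θ Λ hample hlam htower) q J s hJ hq

end SiegelFineModuliScheme

end Literature.AlgebraicGeometry.ModuliOfAbelianVarieties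

end
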